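import Summits.ResolutionOfSingularities.ResolutionOfSingularities.Theorems.PurelyInseparableDim4CrossingLineFixedPoints
import HarnessLib

/-!
# [OURS · res-dim4-pi · F4-C-loc] At the crossing-line fixed point `P₁` the MAXIMAL-DIMENSIONAL-COMPONENT class
  WINS the local game in two moves — one state separating the two rule classes (‖ K over `𝔽₃`, `(p,q) = (3,3)`)

Cell `res-dim4-pi` (D-0157 DOOR 2, wave 2), seat `res-dim4-p-6` g2; sequel of `…CrossingLineFixedPoints`
(p664477: crit-1's `P₁ = x₁x₃²x₄² + x₁³x₂` is a SPINE self-loop under the blow-up of the crossing line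
`V(x₁,x₃,x₄)`, so every crossing-line rule loses there in the spine, local and global games).  Here the other
class at the same state:

* §1 `P1a = x₁x₄² + x₁³x₂` (decorations `r = 0`, `exc = {x₃,x₄}`): the ONLY `𝔽₃`-rational LOCAL equimultiple
  reply to the blow-up of the plane `V(x₁,x₃)` (a maximal-dimensional component of `P₁`) is the origin of the
  `x₃`-chart, and it lands on `P1a` (`local_replies_P1_plane`); `P1a` has the single component `V(x₁,x₄)` and
  NO local equimultiple reply to its blow-up (`no_local_reply_P1a`).
* §2 **`localWin_P1 : LoopCLocal.RWins 3 localB P1.toState`** — the 2-row restricted win certificate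
  `[(P₁, V(x₁,x₃)), (P1a, V(x₁,x₄))]` (p-6's `rwinCertB`, p-14's `ICert` format): A, playing maximal-dimensional
  components, wins the LOCAL in-scope game from `P₁` in two moves; the mirror line `[(P₁, V(x₁,x₄)), …]` works as
  well (`localWin_P1'`).
* §3 **`P1_separates_rule_classes`**: at ONE in-scope state over `𝔽₃` — crossing-line rules have an infinite
  in-scope branch of LOCAL (spine) replies (`CrossingFix.crossing_rule_loses_at_P1`), while the
  maximal-dimensional-component move wins locally.  (Globally the component class is beaten elsewhere — LOOP-C,
  `LoopC.exists_inScope_branch_of_maxDimRule`; nothing is claimed about the global game at `P₁`.)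

Scope (honest): `𝔽₃`-rational replies only; statements about OUR frame's two game readings; nothing here decides
F4-C-loc(3,3) or F4-C-glob(3,3), and NOTHING here is a statement about resolution of singularities — resolution in
dimension `≥ 4` / characteristic `p > 0` is NOT proved by anything in this file.  [OURS · counted 0 · kernel
certificate; AI kernel work, weaker than expert review.]  bears_on: LADDER-RESOLUTION:D157-DOOR2 (res-dim4-pi ·
F4-C-loc(3,3) · C-P1).  Host item (DR-157-C): `stmt-ResolutionOfSingularities-16155`, helper.
-/

set_option linter.dupNamespace false -- mandated namespace of this single-conjunct summit

noncomputable section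

open MvPolynomial Finset

namespace Summit.ResolutionOfSingularities.ResolutionOfSingularities.Theorems.PIDim4

namespace CrossingFix

open Literature.AlgebraicGeometry.Resolution
open Literature.AlgebraicGeometry.Resolution.CentreBlowup
open StepKit LoopC LoopCLocal ComponentThreads InScopeWinCert

/-! ## §1 The one local continuation of `P₁` under the plane `V(x₁,x₃)` -/

/-- `P1a = x₁x₄² + x₁³x₂` — the transform of `P₁` at the origin of the `x₃`-chart of the blow-up of `V(x₁,x₃)`
(decorations `r = 0`, `exc = {x₃,x₄}` carried over). [OURS · data] -/
def P1a : SData 4 (ZMod 3) := ⟨[(![1, 0, 0, 2], 1), (![3, 1, 0, 0], 1)], ![0, 0, 0, 0], {2, 3}⟩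

/-- The plane `V(x₁,x₃)` (`{0,2}`) is a maximal-dimensional component of `P₁` (both components are planes).
[OURS · ‖ K] -/
theorem maxDim_P1_plane : IsComponent 3 ({0, 2} : Finset (Fin 4)) P1.toState.F ∧
    ∀ S', IsComponent 3 S' P1.toState.F → ({0, 2} : Finset (Fin 4)).card ≤ S'.card :=
  (isMaxDim_iff 3 {0, 2} P1.L).mpr (by decide +kernel)

/-- **The local replies to the blow-up of `V(x₁,x₃)` at `P₁`**: over `𝔽₃`, the only equimultiple point over the
current point is the origin of the `x₃`-chart, and the transform there is `P1a`. [OURS · ‖ K] -/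
theorem local_replies_P1_plane : ∀ j ∈ ({0, 2} : Finset (Fin 4)), ∀ b : Fin 4 → ZMod 3, b j = 0 →
    localB {0, 2} j b = true → equiB 3 {0, 2} j b P1 = true → j = 2 ∧ b = 0 ∧
      (stepD 3 {0, 2} j b P1).equivB P1a = true := by
  decide +kernel

/-- `P1a` has exactly one component, the plane `V(x₁,x₄)`. [OURS · ‖ K] -/
theorem components_P1a (S : Finset (Fin 4)) : IsComponent 3 S P1a.toState.F ↔ S = {0, 3} := by
  rw [SData.toState_F, isComponent_iff]
  revert S
  decide +kernel

/-- **No local reply at `P1a`**: the blow-up of `V(x₁,x₄)` has no `𝔽₃`-rational equimultiple point over the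
current point. [OURS · ‖ K] -/
theorem no_local_reply_P1a : ∀ j ∈ ({0, 3} : Finset (Fin 4)), ∀ b : Fin 4 → ZMod 3, b j = 0 →
    localB {0, 3} j b = true → equiB 3 {0, 3} j b P1a = false := by
  decide +kernel

/-- `P1a` is in coordinate scope (witnesses `D^{(0,1,0,0)} = x₁³`, `D^{(0,0,0,2)} = x₁`… i.e. `x₁ · unit`;
the locus through the origin is the plane `V(x₁,x₄)`). [OURS · ‖ K] -/
theorem inScope_P1a : InCoordinateScope 3 P1a.toState.F :=
  inCoordinateScope_toState_of_scopeCertB (W := [(![0, 0, 0, 2], ![1, 0, 0, 0]), (![1, 0, 0, 0], ![0, 0, 0, 2])])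
    (by decide +kernel)

/-! ## §2 The local win certificate from `P₁` -/

/-- The 2-row LOCAL win certificate: A plays `V(x₁,x₃)` at `P₁`, then `V(x₁,x₄)` at `P1a`. [OURS · data] -/
def p1LocalCert : ICert (ZMod 3) := [(P1, {0, 2}, none), (P1a, {0, 3}, none)]

/-- The certificate checks. [OURS · ‖ K] -/
theorem rwinCertB_p1Local : rwinCertB 3 localB p1LocalCert = true := by decide +kernel

/-- **At `P₁` the maximal-dimensional-component class WINS THE LOCAL GAME** (two moves, over `𝔽₃`). [OURS · ‖ K] -/
theorem localWin_P1 : RWins 3 localB P1.toState :=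
  rWins_of_rwinCertB rwinCertB_p1Local (P1, {0, 2}, none) (by simp [p1LocalCert])

/-- The mirror certificate: A plays `V(x₁,x₄)` first (chart-`x₄` origin ↦ `x₁x₃² + x₁³x₂`), then `V(x₁,x₃)`.
[OURS · data] -/
def p1LocalCert' : ICert (ZMod 3) :=
  [(P1, {0, 3}, none), (⟨[(![1, 0, 2, 0], 1), (![3, 1, 0, 0], 1)], ![0, 0, 0, 0], {2, 3}⟩, {0, 2}, none)]

/-- The mirror certificate checks. [OURS · ‖ K] -/
theorem rwinCertB_p1Local' : rwinCertB 3 localB p1LocalCert' = true := by decide +kernel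

/-- The mirror win (same conclusion, the other plane first). [OURS · ‖ K] -/
theorem localWin_P1' : RWins 3 localB P1.toState :=
  rWins_of_rwinCertB rwinCertB_p1Local' (P1, {0, 3}, none) (by simp [p1LocalCert'])

/-! ## §3 One state, two rule classes, two outcomes in the local game -/

/-- **`P₁` SEPARATES THE RULE CLASSES IN THE LOCAL GAME at `(3,3)` over `𝔽₃`**: (i) every rule answering `P₁`
with the crossing line `V(x₁,x₃,x₄)` has an infinite in-scope branch of LOCAL replies from `P₁` (the spine
self-loop); (ii) A wins the LOCAL in-scope game from `P₁` by playing the maximal-dimensional components.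
[OURS · ‖ K] -/
theorem P1_separates_rule_classes :
    (∀ R : CentreRule (ZMod 3), R P1.toState = U1 →
      ∃ c : ℕ → State (ZMod 3), ∀ k, InCoordinateScope 3 (c k).F ∧ IsPermissibleCentre 3 (R (c k)) (c k).F ∧
        RSucc 3 localB (c k) (R (c k)) (c (k + 1))) ∧
    RWins 3 localB P1.toState :=
  ⟨fun R hR => (crossing_rule_loses_at_P1 R hR).2.2, localWin_P1⟩

end CrossingFix

end Summit.ResolutionOfSingularities.ResolutionOfSingularities.Theorems.PIDim4

end
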